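import Summits.CriticalPhenomena.Ising3D.Control2DReadoutWindow
import Summits.CriticalPhenomena.Ising3D.Control2DL11BoxJData2
import Mathlib.Tactic.NormNum
import Mathlib.Tactic.Linarith
import HarnessLib

/-!
# Readout certificate B11 over a WINDOW: `f(4.63) < f(Δ)` for EVERY `Δ ∈ [2.0625, 4.60]` — the near-zero at `4.63 ± 0.03` is the
least value of the scalar-channel action over the whole window `[2.0625, 4.63 + 0.03]` (cell `pub-ising3x`, seat controls-1 gen 29;
KERNEL, certificate kind "readout", continuum form — CONTROL-ONLY)

HONEST FRAMING: lottery ticket; floor = tightest certified 3D Ising CFT bounds; no exact-solution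
claim without a proof. CONTROL-ONLY (`d = 2`, `Δ_σ = 1/8`); a statement about one of our INSTRUMENTS (the kernel-certified Λ = 11
lower-edge box functional `wtboxJ`: RB-2 `j110369` (Λ = 11, E₀ = 32); box `[9/10, 181/200]`), not about a CFT; nothing about `d = 3`.

`Control2DReadoutB11.dip0_B11` samples `f(Δ) = φ[F^{1/8}_-[g_{Δ,0}]]` at `{4, 4.60, 4.63, 4.63+0.03}`. Here `f(4.63) < f(Δ)` is
certified for the CONTINUUM `Δ ∈ [33/16, 23 / 5]` by three Bernstein cells of the window polynomial (`Control2DReadoutWindow.windowCheck`: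
cell polynomial `phatboxJs0 = cellPolyZ wtboxJ slL11 11 0 55` of the landed replay, digit cut `10^339` as in its landed cells, readout truncation
`N = 160`, region threshold `E₀ = 32`). Below `Δ = 2.0625` the action falls to its BINDING zero at the gap edge `Δ = 2` (a boundary zero
of the certificate: `f(2)/f(4.63) ≈ 0.02`), so the window starts just above it. With `dip0_B11` (`f(4.63) < f(4.63 + 0.03)`): over
`[2.0625, 4.63 + 0.03]` the least value is attained only inside `(4.60, 4.63 + 0.03)` — the instrument's first excited near-zero sits at
`δ₀(11) = 0.63 ± 0.03` above `T T̄ = 4` with NO lower excursion anywhere in `[2.0625, 4.60]`. Zero grant compute. No facts, standard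
axioms only. [cite: RattazziEtAl2008, §5.5]
-/

namespace Summit.CriticalPhenomena.Ising3D.Control2D

open Set
open Literature.MathematicalPhysics.QuantumFieldTheory.ConformalBootstrap3D

set_option maxHeartbeats 0 in
set_option maxRecDepth 200000 in
/-- Window cell 1: `y ∈ [33/32, 51/32]` (`Δ ∈ [2.0625, 3.1875]`). [folklore] -/
theorem windowCheck_B11_c1 : windowCheck wtboxJ slL11 11 55 339 160 32 (463 / 100) 32 33 18 phatboxJs0 = true := by
  decide +kernel

set_option maxHeartbeats 0 in
set_option maxRecDepth 200000 in
/-- Window cell 2: `y ∈ [102/64, 121/64]` (`Δ ∈ [3.1875, 3.78125]`). [folklore] -/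
theorem windowCheck_B11_c2 : windowCheck wtboxJ slL11 11 55 339 160 32 (463 / 100) 64 102 19 phatboxJs0 = true := by
  decide +kernel

set_option maxHeartbeats 0 in
set_option maxRecDepth 200000 in
/-- Window cell 3: `y ∈ [605/320, 736/320]` (`Δ ∈ [3.78125, 4.60]`). [folklore] -/
theorem windowCheck_B11_c3 : windowCheck wtboxJ slL11 11 55 339 160 32 (463 / 100) 320 605 131 phatboxJs0 = true := by
  decide +kernel

set_option maxRecDepth 8192 in
/-- **B11 window readout, kernel-complete**: for `φ = taylorFunctional2D (1/2) slL11 wtboxJ` (`Δ_σ = 1/8`, scalar channel) and EVERY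
`Δ ∈ [33/16, 23 / 5]`: `f(463 / 100) < f(Δ)`. CONTROL-ONLY (d = 2). [cite: RattazziEtAl2008, §5.5] -/
theorem window_B11 (Δ : ℝ) (h1 : (33 : ℝ) / 16 ≤ Δ) (h2 : Δ ≤ 23 / 5) :
    taylorFunctional2D (1 / 2) slL11.toFinset (fun p => (wtboxJ p : ℝ)) (crossF (1 / 8) (-1) (globalBlock (463 / 100) 0)) <
      taylorFunctional2D (1 / 2) slL11.toFinset (fun p => (wtboxJ p : ℝ)) (crossF (1 / 8) (-1) (globalBlock Δ 0)) := by
  have hR := region_boxJ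
  have em : (((463 / 100 : ℚ)) : ℝ) = 463 / 100 := by norm_num
  rcases le_total Δ (51 / 16) with hA | hA
  · have h := window_lt_of_windowCheck wtboxJ slL11_nodup slL11_deg phatboxJs0_eq
      (fun b J hb hE => hR b J hb (by exact_mod_cast hE)) windowCheck_B11_c1 (Δ := Δ)
      (by push_cast; linarith) (by push_cast; linarith)
    rwa [em] at h
  rcases le_total Δ (121 / 32) with hB | hB
  · have h := window_lt_of_windowCheck wtboxJ slL11_nodup slL11_deg phatboxJs0_eq
      (fun b J hb hE => hR b J hb (by exact_mod_cast hE)) windowCheck_B11_c2 (Δ := Δ)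
      (by push_cast; linarith) (by push_cast; linarith)
    rwa [em] at h
  · have h := window_lt_of_windowCheck wtboxJ slL11_nodup slL11_deg phatboxJs0_eq
      (fun b J hb hE => hR b J hb (by exact_mod_cast hE)) windowCheck_B11_c3 (Δ := Δ)
      (by push_cast; linarith) (by push_cast; linarith)
    rwa [em] at h

end Summit.CriticalPhenomena.Ising3D.Control2D
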